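import Summits.CriticalPhenomena.PercolationContinuityZ3.Theorems.Transplant.PlanarSkeletonFrmFromDefs
import Summits.CriticalPhenomena.PercolationContinuityZ3.Theorems.Transplant.SkelPhiCorridorKGRoomsQYD
import Summits.CriticalPhenomena.PercolationContinuityZ3.Theorems.Transplant.SkelFrmFromBChoiceDefs3
import Summits.CriticalPhenomena.PercolationContinuityZ3.Theorems.Transplant.SkelFrmBChoiceDefs3
import Summits.CriticalPhenomena.PercolationContinuityZ3.Theorems.Transplant.SkelFrmFromBChoiceGeom
import Summits.CriticalPhenomena.PercolationContinuityZ3.Theorems.Transplant.SkelFrmBChoiceGeom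
import Summits.CriticalPhenomena.PercolationContinuityZ3.Theorems.Transplant.SkelFrmFromBChoiceLinks
import Summits.CriticalPhenomena.PercolationContinuityZ3.Theorems.Transplant.SkelFrmBChoiceLinks
import Summits.CriticalPhenomena.PercolationContinuityZ3.Theorems.Transplant.SkelFrmFromBChoiceKit
import Summits.CriticalPhenomena.PercolationContinuityZ3.Theorems.Transplant.SkelFrmBChoiceKit
import Summits.CriticalPhenomena.PercolationContinuityZ3.Theorems.Transplant.SkelFrmFromBChoiceZone
import Summits.CriticalPhenomena.PercolationContinuityZ3.Theorems.Transplant.SkelFrmBChoiceZone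
import Summits.CriticalPhenomena.PercolationContinuityZ3.Theorems.Transplant.SkelFrmFromBChoiceRooms
import Summits.CriticalPhenomena.PercolationContinuityZ3.Theorems.Transplant.SkelFrmBChoiceRooms
import Summits.CriticalPhenomena.PercolationContinuityZ3.Theorems.Transplant.SkelFrmFromBChoiceNums
import Summits.CriticalPhenomena.PercolationContinuityZ3.Theorems.Transplant.SkelFrmBChoiceNums
import Summits.CriticalPhenomena.PercolationContinuityZ3.Theorems.Transplant.SkelFrmFromBParamsSchedA
import Summits.CriticalPhenomena.PercolationContinuityZ3.Theorems.Transplant.SkelFrmBParamsSchedA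
import Summits.CriticalPhenomena.PercolationContinuityZ3.Theorems.Transplant.SkelFrmFromBParamsCorrKG
import Summits.CriticalPhenomena.PercolationContinuityZ3.Theorems.Transplant.SkelFrmBParamsCorrKG
import HarnessLib
import Summits.CriticalPhenomena.PercolationContinuityZ3.Theorems.Transplant.SkelFrm1ReachRowsQD
/-!
# U-WAVE PORT (RULING D-U, lead g21 2026-08-26; WAVE-U-MANIFEST v3.0 row «SkelFrm1ReachRowsQD» ↦ «SkelFrmFrom1ReachRowsQD») of the tree module
# `Transplant/SkelFrm1ReachRowsQD` onto the carrier `PlanarSkeletonFrmFrom` (frames only, cylinders connected from width `ℓ₀` on)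

ORIGINAL TITLE: N2 (frames-only node `SamePDropOfSkeletonFrm₁`, OPEN), (C) column: THE CORRIDOR RESIDUE OF THE CHOICE FUNCTION OF RECORD AT ONE PROBE, FIRST AXIS,

builds on p205010 (kernel theorem, internal audit signed; external expert review pending) — nothing in this file uses p205010; NOTHING is claimed about the
OPEN node U `SamePDropOfSkeletonFrmFrom₁` (nor U_s / the end state).  Lane `prim-bschramm`, seat `prim-bschramm-p3` gen 26; helper file
(`--supports stmt-CriticalPhenomena-4575 --as helper`).  PORT RULES r1–r4 of RULING D-U: declaration order and proof texts are those of the original,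
byte-identical except (i) the carrier token `PlanarSkeletonFrm ↦ PlanarSkeletonFrmFrom` (binders, `namespace`/`end` lines, qualified names of twinned
declarations), (ii) carrier-FREE declarations of the original (φ-level `Skelφ…` blocks and namespace-only arithmetic residents) are NOT re-declared —
this file imports the original and `export`s the twin-free residents (POLICY T / treatment (m1)); residents whose statement mentions a twinned
constant are copied, (iii) every carrier-binding declaration keeps its explicit binder `(Φ : PlanarSkeletonFrmFrom G)` in its own signature (r2).  Docstrings and citations are the original's.
-/

noncomputable section

open MeasureTheory ProbabilityTheory
open scoped ENNReal Classical

namespace Summit.CriticalPhenomena.PercolationContinuityZ3.Theorems.Transplant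

namespace PlanarSkeletonFrmFrom

open Literature.Probability.Percolation Literature.Probability.LatticeModels SimpleGraph GadgetSystem ProbeHistory HSiteScheme Contour KNCells
open Literature.Probability.Percolation.KozmaNitzan.Cells (oth sgOf)
open KNCells.KSchA KNLevels ChainPlanar ChainPara
open Literature.Barriers.CriticalPhenomena (HasExponentialGrowth graphBall graphBall_mono mem_graphBall_self)
open Skel (ReachOblAtHNF excess)
open SkelI (tanOff)
open SkelConc (Consts)
open BoxProdZ2 (ConcRadiiG)
open TwoAxis.Para (modulus)
open Skelφ (oriφ trφ)
open Skelφ.StepI (DataN DataNS OutNS)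

namespace NegB

open Neg

section Fst

variable {κ : Consts} {V : Type} [DecidableEq V] [Countable V] {G : SimpleGraph V} [G.LocallyFinite] {Φ : PlanarSkeletonFrmFrom G} {t : V} {p : unitInterval}
  {hC : Φ.CylSubcritical p} {gv fv : Neg.FSlot} {Pv : PSlot} {Sv : SSlot} {cv : CSlot} {bv : BSlot} {O : OutNS V} {q : unitInterval}

set_option hygiene false in local notation "g°" => PlanarSkeletonFrmFrom.NegB.gOf κ Φ t p O gv
set_option hygiene false in local notation "f°" => PlanarSkeletonFrmFrom.NegB.fOf κ Φ t p O fv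
set_option hygiene false in local notation "c°" => PlanarSkeletonFrmFrom.NegB.cOf κ Φ t p O gv fv cv
set_option hygiene false in local notation "nL°" => PlanarSkeletonFrmFrom.NegB.nL κ Φ t p O.merged g° f°
set_option hygiene false in local notation "ℓL°" => PlanarSkeletonFrmFrom.NegB.ℓL κ Φ t p O.merged g° f°
set_option hygiene false in local notation "hL°" => PlanarSkeletonFrmFrom.NegB.hL κ Φ t p O.merged g° f°
set_option hygiene false in local notation "vL°" => PlanarSkeletonFrmFrom.NegB.vL κ Φ t p O.merged g° f°
set_option hygiene false in local notation "vβL°" => PlanarSkeletonFrmFrom.NegB.vβL κ Φ t p O.merged g° f°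
set_option hygiene false in local notation "φL°" => PlanarSkeletonFrmFrom.NegB.φL κ Φ t p O.D O.DT.toDataN O.ori g° f°
set_option hygiene false in local notation "ψ°" => PlanarSkeletonFrmFrom.NegB.fineOA κ Φ t p O.D O.DT.toDataN O.ori g° f°
set_option hygiene false in local notation "P°" => PlanarSkeletonFrmFrom.NegB.fcellsS κ Φ t p O.merged g° f° c°
set_option hygiene false in local notation "Λ°" => PlanarSkeletonFrmFrom.NegB.schedOfS κ Φ t p O.merged g° f° c° (Sv κ Φ t p O.merged g° f° q)
set_option hygiene false in local notation "b°" => PlanarSkeletonFrmFrom.NegB.bOf κ Φ t p O gv fv bv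
set_option hygiene false in local notation "F°" => PlanarSkeletonFrmFrom.NegB.prFA κ Φ t p O.merged g° f°
set_option hygiene false in local notation "S°" => (KSchA.mk (PlanarSkeletonFrmFrom.NegB.ΓQ κ Φ t p O gv fv Sv cv bv q) q κ.δ : KSchA V ℕ)
set_option hygiene false in local notation "FD°" => PlanarSkeletonFrmFrom.NegB.FDQ κ Φ t p O gv fv Sv cv q
set_option hygiene false in local notation "e₀" => (((0 : Fin 2), true) : MDir)

/-- **The oriented fine map of record IS the fine skeleton at the lattice record `prFA`** (by `rfl`). [folklore] -/
theorem fineOA_eq_fineSkel {κ : Consts} {V : Type} [DecidableEq V] [Countable V] {G : SimpleGraph V} [G.LocallyFinite] {Φ : PlanarSkeletonFrmFrom G} {t : V} {p : unitInterval} {gv : Neg.FSlot} {fv : Neg.FSlot} {O : OutNS V} :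
    ψ° = Skelφ.fineSkel φL° t (F°).A nL° hL° vL° vβL° (F°).c₀ (F°).c₁ ((F°).D / 2) ((F°).D / 2) (F°).D := rfl

/-- **THE (C) RESIDUE OF THE CHOICE FUNCTION OF RECORD AT ONE PROBE, FIRST AXIS** — every structural binder discharged; numeric rows, corridor records
(`R′ := KS0.R'0`, `ρ := 0`), world rows and budget left as named hypotheses in the ledger's vocabulary.
[cite: KozmaNitzan2024, §4 Lemma 12 (pp. 23–25), p. 30 (Step IV)] -/
theorem reachOblAtHNF_frmQ3D_fst {κ : Consts} {V : Type} [DecidableEq V] [Countable V] {G : SimpleGraph V} [G.LocallyFinite] {Φ : PlanarSkeletonFrmFrom G} {t : V} {p : unitInterval} {hC : Φ.CylSubcritical p} {gv : Neg.FSlot} {fv : Neg.FSlot} {Pv : PSlot} {Sv : SSlot} {cv : CSlot} {bv : BSlot} {O : OutNS V} {q : unitInterval} (hAt : (choiceAtQ3 κ Φ t p Pv gv fv Sv cv bv hC).AtQNQ O q) (h1 : Φ.types = {t})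
    (hp0 : 0 < (p : ℝ)) (hp1 : (p : ℝ) < 1) (mk : ℕ)
    -- the probe
    {h : ProbeHistory V} {e : Site 2 × MDir} (hV : (S°).Valid₂O G h e) (hdu : e₀ ∈ (S°).onwardO G h (tgt e)) (hne : e₀ ≠ rev e.2)
    -- the corridor of record: the K-G row set at `R′ := KS0.R'0` and a run length `N` (stmt-g20: `kgRows0_of …`, `N := kgNv0 …`)
    {ρ qq W : ℕ} (HK : Skelφ.KGRows nL° ℓL° hL° vL° (KS0.R'0 κ Φ t p O.merged mk) ρ qq W) (N : ℕ)
    -- the window radius (`≥ r₀0 … Rl`, the late near/far threshold of the kit at the long prism radius)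
    {R : ℕ} (hr₀R : KS0.r₀0 t O.merged mk (RL κ Φ t p O gv fv) ≤ R)
    -- RADIUS ROWS of the schedule of record
    (hDQ : R + 1 ≤ (Λ°).rQ ((S°).aOf₁O G h e) (tgt e))
    (hDρ' : ∀ l, R + 1 ≤ (Λ°).ρ ((S°).aOf₂O G h e) (tgt e) e₀ l)
    (hρM : ∀ l, (Λ°).ρ ((S°).aOf₂O G h e) (tgt e) e₀ l + 1 ≤ (Λ°).rM ((S°).aOf₂O G h e) (tgt e + stepVec e₀))
    -- THE ENTRANCE DEPTH (J15; the wrapper: `deep_of_run₂bOS`, `R₀ := E(nS α v)`)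
    {R₀ : ℕ} (hdeep : ∀ a ∈ (S°).Vx G h, ∀ b ∈ (S°).Γ.Ewv ((S°).aOf₁O G h e) e.1 e.2 ∪ (FD°).Hfull ((S°).aOf₂O G h e) (tgt e) e₀,
      b ∉ (S°).Vx G h → G.Adj a b → a ∈ graphBall G t R₀)
    -- READING ROWS of the prism box at the lattice record `prFA`
    (hPl : -(5 * ((P°).r 0 : ℤ)) + 1 ≤ Skelφ.rdLo (F°).A nL° hL° vL° vβL° (F°).c₀ (F°).c₁ (F°).D
        (![-Skelφ.kgZ₀ nL° vL° (KS0.R'0 κ Φ t p O.merged mk) ρ qq N (Skelφ.kgM₁ nL° ℓL° hL° (KS0.R'0 κ Φ t p O.merged mk) ρ W N) (Skelφ.kgM₂ nL° ℓL° hL° vL° (KS0.R'0 κ Φ t p O.merged mk) ρ qq W N), -Skelφ.kgZ₁ nL° ℓL° hL° (KS0.R'0 κ Φ t p O.merged mk) ρ W N (Skelφ.kgM₁ nL° ℓL° hL° (KS0.R'0 κ Φ t p O.merged mk) ρ W N) (Skelφ.kgWm₂ nL° ℓL° hL° (KS0.R'0 κ Φ t p O.merged mk) ρ W N) (Skelφ.kgWp₂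 nL° ℓL° hL° (KS0.R'0 κ Φ t p O.merged mk) ρ W N) (Skelφ.kgM₂ nL° ℓL° hL° vL° (KS0.R'0 κ Φ t p O.merged mk) ρ qq W N)])
        (![((N : ℤ) + 1) * nL° + Skelφ.kgZ₀ nL° vL° (KS0.R'0 κ Φ t p O.merged mk) ρ qq N (Skelφ.kgM₁ nL° ℓL° hL° (KS0.R'0 κ Φ t p O.merged mk) ρ W N) (Skelφ.kgM₂ nL° ℓL° hL° vL° (KS0.R'0 κ Φ t p O.merged mk) ρ qq W N), Skelφ.kgZ₁ nL° ℓL° hL° (KS0.R'0 κ Φ t p O.merged mk) ρ W N (Skelφ.kgM₁ nL° ℓL° hL° (KS0.R'0 κ Φ t p O.merged mk) ρ W N) (Skelφ.kgWm₂ nL° ℓL° hL° (KS0.R'0 κ Φ t p O.merged mk) ρ W N) (Skelφ.kgWp₂ nL° ℓL° hL° (KS0.R'0 κ Φ t p O.merged mk) ρ W N) (Skelφ.kgM₂ nL° ℓL° hL° vL° (KS0.R'0 κ Φ t p O.merged mk) ρ qq W N)]) 0 ∧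
      Skelφ.rdHi (F°).A nL° hL° vL° vβL° (F°).c₀ (F°).c₁ (F°).D
        (![-Skelφ.kgZ₀ nL° vL° (KS0.R'0 κ Φ t p O.merged mk) ρ qq N (Skelφ.kgM₁ nL° ℓL° hL° (KS0.R'0 κ Φ t p O.merged mk) ρ W N) (Skelφ.kgM₂ nL° ℓL° hL° vL° (KS0.R'0 κ Φ t p O.merged mk) ρ qq W N), -Skelφ.kgZ₁ nL° ℓL° hL° (KS0.R'0 κ Φ t p O.merged mk) ρ W N (Skelφ.kgM₁ nL° ℓL° hL° (KS0.R'0 κ Φ t p O.merged mk) ρ W N) (Skelφ.kgWm₂ nL° ℓL° hL° (KS0.R'0 κ Φ t p O.merged mk) ρ W N) (Skelφ.kgWp₂ nL° ℓL° hL° (KS0.R'0 κ Φ t p O.merged mk) ρ W N) (Skelφ.kgM₂ nL° ℓL° hL° vL° (KS0.R'0 κ Φ t p O.merged mk) ρ qq W N)])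
        (![((N : ℤ) + 1) * nL° + Skelφ.kgZ₀ nL° vL° (KS0.R'0 κ Φ t p O.merged mk) ρ qq N (Skelφ.kgM₁ nL° ℓL° hL° (KS0.R'0 κ Φ t p O.merged mk) ρ W N) (Skelφ.kgM₂ nL° ℓL° hL° vL° (KS0.R'0 κ Φ t p O.merged mk) ρ qq W N), Skelφ.kgZ₁ nL° ℓL° hL° (KS0.R'0 κ Φ t p O.merged mk) ρ W N (Skelφ.kgM₁ nL° ℓL° hL° (KS0.R'0 κ Φ t p O.merged mk) ρ W N) (Skelφ.kgWm₂ nL° ℓL° hL° (KS0.R'0 κ Φ t p O.merged mk) ρ W N) (Skelφ.kgWp₂ nL° ℓL° hL° (KS0.R'0 κ Φ t p O.merged mk) ρ W N) (Skelφ.kgM₂ nL° ℓL° hL° vL° (KS0.R'0 κ Φ t p O.merged mk) ρ qq W N)]) 0 ≤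
        22 * ((P°).r 0 : ℤ) - 1)
    (hPt : -(2 * ((P°).r 1 : ℤ)) + 1 ≤ Skelφ.rdLo (F°).A nL° hL° vL° vβL° (F°).c₀ (F°).c₁ (F°).D
        (![-Skelφ.kgZ₀ nL° vL° (KS0.R'0 κ Φ t p O.merged mk) ρ qq N (Skelφ.kgM₁ nL° ℓL° hL° (KS0.R'0 κ Φ t p O.merged mk) ρ W N) (Skelφ.kgM₂ nL° ℓL° hL° vL° (KS0.R'0 κ Φ t p O.merged mk) ρ qq W N), -Skelφ.kgZ₁ nL° ℓL° hL° (KS0.R'0 κ Φ t p O.merged mk) ρ W N (Skelφ.kgM₁ nL° ℓL° hL° (KS0.R'0 κ Φ t p O.merged mk) ρ W N) (Skelφ.kgWm₂ nL° ℓL° hL° (KS0.R'0 κ Φ t p O.merged mk) ρ W N) (Skelφ.kgWp₂ nL° ℓL° hL° (KS0.R'0 κ Φ t p O.merged mk) ρ W N) (Skelφ.kgM₂ nL° ℓL° hL° vL° (KS0.R'0 κ Φ t p O.merged mk) ρ qq W N)])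
        (![((N : ℤ) + 1) * nL° + Skelφ.kgZ₀ nL° vL° (KS0.R'0 κ Φ t p O.merged mk) ρ qq N (Skelφ.kgM₁ nL° ℓL° hL° (KS0.R'0 κ Φ t p O.merged mk) ρ W N) (Skelφ.kgM₂ nL° ℓL° hL° vL° (KS0.R'0 κ Φ t p O.merged mk) ρ qq W N), Skelφ.kgZ₁ nL° ℓL° hL° (KS0.R'0 κ Φ t p O.merged mk) ρ W N (Skelφ.kgM₁ nL° ℓL° hL° (KS0.R'0 κ Φ t p O.merged mk) ρ W N) (Skelφ.kgWm₂ nL° ℓL° hL° (KS0.R'0 κ Φ t p O.merged mk) ρ W N) (Skelφ.kgWp₂ nL° ℓL° hL° (KS0.R'0 κ Φ t p O.merged mk) ρ W N) (Skelφ.kgM₂ nL° ℓL° hL° vL° (KS0.R'0 κ Φ t p O.merged mk) ρ qq W N)]) 1 ∧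
      Skelφ.rdHi (F°).A nL° hL° vL° vβL° (F°).c₀ (F°).c₁ (F°).D
        (![-Skelφ.kgZ₀ nL° vL° (KS0.R'0 κ Φ t p O.merged mk) ρ qq N (Skelφ.kgM₁ nL° ℓL° hL° (KS0.R'0 κ Φ t p O.merged mk) ρ W N) (Skelφ.kgM₂ nL° ℓL° hL° vL° (KS0.R'0 κ Φ t p O.merged mk) ρ qq W N), -Skelφ.kgZ₁ nL° ℓL° hL° (KS0.R'0 κ Φ t p O.merged mk) ρ W N (Skelφ.kgM₁ nL° ℓL° hL° (KS0.R'0 κ Φ t p O.merged mk) ρ W N) (Skelφ.kgWm₂ nL° ℓL° hL° (KS0.R'0 κ Φ t p O.merged mk) ρ W N) (Skelφ.kgWp₂ nL° ℓL° hL° (KS0.R'0 κ Φ t p O.merged mk) ρ W N) (Skelφ.kgM₂ nL° ℓL° hL° vL° (KS0.R'0 κ Φ t p O.merged mk) ρ qq W N)])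
        (![((N : ℤ) + 1) * nL° + Skelφ.kgZ₀ nL° vL° (KS0.R'0 κ Φ t p O.merged mk) ρ qq N (Skelφ.kgM₁ nL° ℓL° hL° (KS0.R'0 κ Φ t p O.merged mk) ρ W N) (Skelφ.kgM₂ nL° ℓL° hL° vL° (KS0.R'0 κ Φ t p O.merged mk) ρ qq W N), Skelφ.kgZ₁ nL° ℓL° hL° (KS0.R'0 κ Φ t p O.merged mk) ρ W N (Skelφ.kgM₁ nL° ℓL° hL° (KS0.R'0 κ Φ t p O.merged mk) ρ W N) (Skelφ.kgWm₂ nL° ℓL° hL° (KS0.R'0 κ Φ t p O.merged mk) ρ W N) (Skelφ.kgWp₂ nL° ℓL° hL° (KS0.R'0 κ Φ t p O.merged mk) ρ W N) (Skelφ.kgM₂ nL° ℓL° hL° vL° (KS0.R'0 κ Φ t p O.merged mk) ρ qq W N)]) 1 ≤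
        2 * ((P°).r 1 : ℤ) - 1)
    -- READING ROWS of the arrival box `[kgLastLo, kgLastHi]` (SkelPhiCorridorKGBoxes)
    (hLl : 20 * ((P°).r 0 : ℤ) - b° 0 + 1 ≤ Skelφ.rdLo (F°).A nL° hL° vL° vβL° (F°).c₀ (F°).c₁ (F°).D (HK.kgLastLo N) (HK.kgLastHi N) 0 ∧
      5 * ((P°).r 0 : ℤ) ≤ Skelφ.rdLo (F°).A nL° hL° vL° vβL° (F°).c₀ (F°).c₁ (F°).D (HK.kgLastLo N) (HK.kgLastHi N) 0 ∧
      Skelφ.rdHi (F°).A nL° hL° vL° vβL° (F°).c₀ (F°).c₁ (F°).D (HK.kgLastLo N) (HK.kgLastHi N) 0 ≤ 20 * ((P°).r 0 : ℤ) + b° 0 - 1 ∧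
      Skelφ.rdHi (F°).A nL° hL° vL° vβL° (F°).c₀ (F°).c₁ (F°).D (HK.kgLastLo N) (HK.kgLastHi N) 0 ≤ 22 * ((P°).r 0 : ℤ))
    (hLt : PCells2S.cenS P° (tgt e + stepVec e₀) 1 - PCells2S.cenS P° (tgt e) 1 - b° 1 + 1 ≤ Skelφ.rdLo (F°).A nL° hL° vL° vβL° (F°).c₀ (F°).c₁ (F°).D (HK.kgLastLo N) (HK.kgLastHi N) 1 ∧
      Skelφ.rdHi (F°).A nL° hL° vL° vβL° (F°).c₀ (F°).c₁ (F°).D (HK.kgLastLo N) (HK.kgLastHi N) 1 ≤ PCells2S.cenS P° (tgt e + stepVec e₀) 1 - PCells2S.cenS P° (tgt e) 1 + b° 1 - 1 ∧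
      -(2 * ((P°).r 1 : ℤ)) ≤ Skelφ.rdLo (F°).A nL° hL° vL° vβL° (F°).c₀ (F°).c₁ (F°).D (HK.kgLastLo N) (HK.kgLastHi N) 1 ∧
      Skelφ.rdHi (F°).A nL° hL° vL° vβL° (F°).c₀ (F°).c₁ (F°).D (HK.kgLastLo N) (HK.kgLastHi N) 1 ≤ 2 * ((P°).r 1 : ℤ))
    -- START-BOX ROWS
    {aW Bx bL : ℤ} (ha : (F°).D * ((F°).c₁ * (nL° : ℤ) * (b° 0 + 1) + (F°).c₀ * |vL°| * (b° 1 + 1)) ≤ (F°).c₀ * (F°).c₁ * (F°).A * modulus nL° hL° vL° vβL° * aW)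
    (hBx : (F°).D * ((b° 1 : ℤ) + 1) ≤ (F°).c₁ * (F°).A * Bx) (hbL : Bx / (Skelφ.shearUnit nL° hL° : ℤ) + 1 ≤ bL)
    (haq : aW ≤ qq) (hbW : bL ≤ ((nL° * ℓL° / Skelφ.shearUnit nL° hL° + 1 + W : ℕ) : ℤ))
    -- DEPTH ROW (column origin at depth `cOffS·‖tgt e‖₁ + 1`)
    (hRD : ((cOffS κ Φ t p O.merged g° f° * (((tgt e) 0).natAbs + ((tgt e) 1).natAbs) + 1 : ℕ) : ℤ) +
      (10 + 3) * (((N : ℤ) + 1) * nL° + Skelφ.kgZ₀ nL° vL° (KS0.R'0 κ Φ t p O.merged mk) ρ qq N (Skelφ.kgM₁ nL° ℓL° hL° (KS0.R'0 κ Φ t p O.merged mk) ρ W N) (Skelφ.kgM₂ nL° ℓL° hL° vL° (KS0.R'0 κ Φ t p O.merged mk) ρ qq W N) +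
        Skelφ.kgZ₁ nL° ℓL° hL° (KS0.R'0 κ Φ t p O.merged mk) ρ W N (Skelφ.kgM₁ nL° ℓL° hL° (KS0.R'0 κ Φ t p O.merged mk) ρ W N) (Skelφ.kgWm₂ nL° ℓL° hL° (KS0.R'0 κ Φ t p O.merged mk) ρ W N) (Skelφ.kgWp₂ nL° ℓL° hL° (KS0.R'0 κ Φ t p O.merged mk) ρ W N) (Skelφ.kgM₂ nL° ℓL° hL° vL° (KS0.R'0 κ Φ t p O.merged mk) ρ qq W N)) ≤ R)
    -- THE RIM EXCESS DEVICE: world rows, excess radius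
    {φe : V → Site 2} {Rw m' m R₁ : ℕ} {ctr : Site 2}
    (hWπ : ∀ b ∈ (S°).Γ.Ewv ((S°).aOf₁O G h e) e.1 e.2 ∪ (FD°).Hfull ((S°).aOf₂O G h e) (tgt e) e₀, b ∈ graphBall G t Rw)
    (hWpl : ∀ b ∈ (S°).Γ.Ewv ((S°).aOf₁O G h e) e.1 e.2 ∪ (FD°).Hfull ((S°).aOf₂O G h e) (tgt e) e₀, φe b ∈ (box 2 m').image (fun s => s + ctr))
    (hm : 2 * m' ≤ m)
    (hR₁ : ∀ R'', R₁ ≤ R'' → ∀ (Rw' : ℕ) (D' A' : Finset V), (∀ d ∈ D', d ∈ graphBall G t Rw') →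
      (∀ d ∈ D', ∀ d' ∈ D', φe d - φe d' ∈ box 2 m) → A' ⊆ D' → (∀ a ∈ A', a ∈ graphBall G t (R₀ + 1)) →
        (bondPercolation G q).real (excess G t R'' D' A') ≤ κ.δr 0 / 2)
    (hR₁R : R₁ ≤ R - KS0.r₀0 t O.merged mk (RL κ Φ t p O gv fv))
    -- the budget
    {nmax : ℕ} (hnmax : (Skelφ.kgCorrSched (HK.kgVals_ok₁ N) (HK.kgVals_ok₂ N) (HK.kgVals_split N)).N ≤ nmax) :
    ReachOblAtHNF G nmax S° FD° Φ.Δ (κ.δr 0) h e ((S°).aOf₂O G h e) e₀ := by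
  -- the long clause and its numerics
  have hN := eqNumL_of_atQ hAt
  obtain ⟨hn1, hℓ1⟩ := one_le_of_eqNumL κ Φ t p O.merged g° f° hN
  have hκL := (clauseL_of_atQ hAt).2
  obtain ⟨-, hq1, hq2, -⟩ := factsNS_of_atQ hAt
  -- the frame
  have hlipφ := lip_φL κ Φ t p O.D O.DT.toDataN O.ori g° f°
  have hstep := steps_φL κ Φ t p O.D O.DT.toDataN O.ori g° f°
  -- the Γ package at the staggered cells
  obtain ⟨-, -, -, -, -, -, hEx, hSt, hL⟩ := geom_fineA_at_bS κ Φ t p O.merged g° f° c° hlipφ hstep hN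
    (schedOfS_WFS2 κ Φ t p O.merged g° f° c° (Sv κ Φ t p O.merged g° f° q)) (colQ_schedOfS κ Φ t p O.merged g° f° c° (Sv κ Φ t p O.merged g° f° q))
    (b₀ := b°) (bOf_le κ Φ t p O gv fv cv bv)
  -- the kit block
  obtain ⟨hPN, hdD, hDρ, hKCmax, hT, -⟩ := KS0.kit0_ok t O.merged mk ((Mu O.merged + 1 : ℕ) * (Skelφ.shearUnit nL° hL° : ℤ) + 1)
    (KS0.r₀0 t O.merged mk (RL κ Φ t p O gv fv)) (kq := 10) le_rfl
  obtain ⟨hrs, hcS⟩ := KS0.kit0_sizes Φ t O.merged mk ((Mu O.merged + 1 : ℕ) * (Skelφ.shearUnit nL° hL° : ℤ) + 1) (KS0.r₀0 t O.merged mk (RL κ Φ t p O gv fv))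
  obtain ⟨hr₀, hr₀1⟩ := KS0.hr₀_kit0 t O.merged mk ((Mu O.merged + 1 : ℕ) * (Skelφ.shearUnit nL° hL° : ℤ) + 1) (KS0.r₀0_ge t O.merged mk (RL κ Φ t p O gv fv)).1
  have hreach := KS0.hreach_kit0 t O.merged mk ((Mu O.merged + 1 : ℕ) * (Skelφ.shearUnit nL° hL° : ℤ) + 1) (KS0.r₀0_ge t O.merged mk (RL κ Φ t p O gv fv)).2
  -- the counts at the flat root accuracy
  obtain ⟨hk, hcount⟩ := KS0.counts_atq_root κ Φ t p O.merged mk hp0 hp1 hq1 hq2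
  -- levels
  have hE : KS0.j₁0 κ Φ t p O.merged mk +
      ((KS0.kit0 t O.merged mk ((Mu O.merged + 1 : ℕ) * (Skelφ.shearUnit nL° hL° : ℤ) + 1) (KS0.r₀0 t O.merged mk (RL κ Φ t p O gv fv))).N *
          (tanOff (KS0.kit0 t O.merged mk ((Mu O.merged + 1 : ℕ) * (Skelφ.shearUnit nL° hL° : ℤ) + 1) (KS0.r₀0 t O.merged mk (RL κ Φ t p O gv fv))).ℓs
            (KS0.kit0 t O.merged mk ((Mu O.merged + 1 : ℕ) * (Skelφ.shearUnit nL° hL° : ℤ) + 1) (KS0.r₀0 t O.merged mk (RL κ Φ t p O gv fv))).M + 1) +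
        (KS0.kit0 t O.merged mk ((Mu O.merged + 1 : ℕ) * (Skelφ.shearUnit nL° hL° : ℤ) + 1) (KS0.r₀0 t O.merged mk (RL κ Φ t p O gv fv))).N *
          (KS0.kit0 t O.merged mk ((Mu O.merged + 1 : ℕ) * (Skelφ.shearUnit nL° hL° : ℤ) + 1) (KS0.r₀0 t O.merged mk (RL κ Φ t p O gv fv))).d +
        KS.KCmax t O.merged mk) ≤ KS0.R'0 κ Φ t p O.merged mk := by
    rw [KS0.tanOff_kit0]
    simp only [KS0.kit0]
    have h := (KS0.R'0_eq κ Φ t p O.merged mk).1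
    unfold KS0.reach0 at h
    omega
  exact Skelφ.reachOblAtHNF_of_kgCorrSD (φ := φL°) (ψ := ψ°) (P := P°) (w₀ := t) (Λ := Λ°) (b₀ := b°) (q := q) (δc := κ.δ)
    (hψ := fineOA_eq_fineSkel) (hAp := (Aof_pos κ).1) (hmp := Skelφ.NegPrm.modulus_vβOf_pos hn1 hℓ1 _ _)
    (hc₀p := (prFA_c_pos κ Φ t p O.merged g° f°).1) (hc₁p := (prFA_c_pos κ Φ t p O.merged g° f°).2)
    (hDp := Skelφ.NegPrm.DofA_pos (Aof_pos κ).2 hn1 hℓ1 _ _)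
    (hlip := lip_fineA_at κ Φ t p O.merged g° f° hlipφ hN) (hws := weakSteps_fineA_at κ Φ t p O.merged g° f° hstep hN)
    (hb := bOf_le κ Φ t p O gv fv cv bv) (hL := hL) (hSt := hSt) (hEx := hEx) (hV := hV) (hdu := hdu) (hdu' := hne)
    (hlipφ := hlipφ) (hstep := hstep) (hΔ := Φ.degree_le) (hn := hn1)
    (c₀ := colVS κ Φ t p O.merged g° f° c° hlipφ hstep hN (tgt e)) (kq := 10) (hκL := hκL)
    (hctr := colVS_eq κ Φ t p O.merged g° f° c° hlipφ hstep hN (tgt e))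
    (hP₁ := HK.kgVals_ok₁ N) (hP₂ := HK.kgVals_ok₂ N) (hsplit := HK.kgVals_split N) (r := RL κ Φ t p O gv fv) (hr := le_rfl)
    (hrR := le_trans (Nat.le_add_right _ _) ((KS0.r₀0_ge t O.merged mk (RL κ Φ t p O gv fv)).2.trans hr₀R))
    (Pk := KS0.kit0 t O.merged mk ((Mu O.merged + 1 : ℕ) * (Skelφ.shearUnit nL° hL° : ℤ) + 1) (KS0.r₀0 t O.merged mk (RL κ Φ t p O gv fv)))
    (hPN := hPN) (hA := rfl) (hdD := hdD) (hDρ := hDρ) (hKCmax := hKCmax) (hT := hT) (hr₀ := hr₀) (hR := hr₀R) (hr₀1 := hr₀1)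
    (hrs := hrs) (hcS := hcS) (hreach := hreach)
    (Rg := fun c => KS.RgK G t O.merged mk (KS.φK Φ t O.D O.DT.toDataN O.ori mk) c)
    (hRg := fun c => KS.RgK_subset_graphBall t O.merged mk _ c) (hRgcard := fun c => KS.card_RgK_le Φ t O.merged mk _ c)
    (hcU1 := Nat.one_le_pow _ _ (Nat.succ_pos _))
    (Λc := O.merged.Λ) (kz := Mu O.merged) (hΛRg := hΛRg_of_atQ mk hAt) (hzconn := hzconn_of_atQ hAt) (hcz := hcz_of_atQ hAt)
    (hj0 := (KS0.tanOff_kit0 t O.merged mk _ _).le) (hj := (KS0.R'0_eq κ Φ t p O.merged mk).2.2) (hRl := (KS0.R'0_eq κ Φ t p O.merged mk).2.1.le)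
    (hE := hE) (hδ := (κ.hδr 0).1) (hη := le_rfl) (kk := KS0.kk0 κ Φ t p O.merged mk) (hN := KS0.hNk0_at κ Φ t p O.merged mk hp0 hp1)
    (hk := hk) (hcount := hcount)
    (hDQ := hDQ) (hDρ' := hDρ') (hρM := hρM) (hdeep := hdeep) (hPl := hPl) (hPt := hPt) (hlast := fun y hy => HK.mem_Icc_of_mem_last N hy) (hLl := hLl) (hLt := hLt)
    (ha := ha) (hBx := hBx) (hbL := hbL) (haq := haq) (hbW := hbW)
    (hc₀ := colVS_mem_graphBall_lin κ Φ t p O.merged g° f° c° hlipφ hstep hN hκL (tgt e)) (hRD := hRD)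
    (hWπ := hWπ) (hWpl := hWpl) (hm := hm) (hR₁ := hR₁) (hR₁R := hR₁R)
    (hlong := hlong_of_atQ3 hAt h1 (Neg.δkit_le_δr κ Φ (by norm_num)))
    (hlongY := hlongY_of_atQ3 hAt h1 (Neg.δkit_le_δr κ Φ (by norm_num)))
    (hnmax := hnmax)

/-! ## §2 Second axis -/

set_option hygiene false in local notation "e₁" => (((1 : Fin 2), true) : MDir)

/-- **THE (C) RESIDUE OF THE CHOICE FUNCTION OF RECORD AT ONE PROBE, SECOND AXIS** (over `reachOblAtHNF_of_kgCorrYS`; the schedule's frame rows are the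
`KGYRows` fields `hn/hv/hlay`). [cite: KozmaNitzan2024, §4 Lemma 12 (pp. 23–25), p. 30 (Step IV)] -/
theorem reachOblAtHNF_frmQ3D_snd {κ : Consts} {V : Type} [DecidableEq V] [Countable V] {G : SimpleGraph V} [G.LocallyFinite] {Φ : PlanarSkeletonFrmFrom G} {t : V} {p : unitInterval} {hC : Φ.CylSubcritical p} {gv : Neg.FSlot} {fv : Neg.FSlot} {Pv : PSlot} {Sv : SSlot} {cv : CSlot} {bv : BSlot} {O : OutNS V} {q : unitInterval} (hAt : (choiceAtQ3 κ Φ t p Pv gv fv Sv cv bv hC).AtQNQ O q) (h1 : Φ.types = {t})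
    (hp0 : 0 < (p : ℝ)) (hp1 : (p : ℝ) < 1) (mk : ℕ)
    -- the probe
    {h : ProbeHistory V} {e : Site 2 × MDir} (hV : (S°).Valid₂O G h e) (hdu : e₁ ∈ (S°).onwardO G h (tgt e)) (hne : e₁ ≠ rev e.2)
    -- the corridor of record, second axis: the K-G row set at `R′ := KS0.R'0` and a run length `N` (stmt-g20: `kgYRows0_of …`, `N := kgNYv0 …`)
    {ρ qq W : ℕ} (HK : Skelφ.KGYRows nL° ℓL° hL° vL° (KS0.R'0 κ Φ t p O.merged mk) ρ qq W) (N : ℕ)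
    -- the window radius
    {R : ℕ} (hr₀R : KS0.r₀0 t O.merged mk (RL κ Φ t p O gv fv) ≤ R)
    -- RADIUS ROWS of the schedule of record
    (hDQ : R + 1 ≤ (Λ°).rQ ((S°).aOf₁O G h e) (tgt e))
    (hDρ' : ∀ l, R + 1 ≤ (Λ°).ρ ((S°).aOf₂O G h e) (tgt e) e₁ l)
    (hρM : ∀ l, (Λ°).ρ ((S°).aOf₂O G h e) (tgt e) e₁ l + 1 ≤ (Λ°).rM ((S°).aOf₂O G h e) (tgt e + stepVec e₁))
    -- THE ENTRANCE DEPTH (J15; the wrapper: `deep_of_run₂bOS`, `R₀ := E(nS α v)`)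
    {R₀ : ℕ} (hdeep : ∀ a ∈ (S°).Vx G h, ∀ b ∈ (S°).Γ.Ewv ((S°).aOf₁O G h e) e.1 e.2 ∪ (FD°).Hfull ((S°).aOf₂O G h e) (tgt e) e₁,
      b ∉ (S°).Vx G h → G.Adj a b → a ∈ graphBall G t R₀)
    -- READING ROWS of the prism box `[(−ZY₀, −ZY₁), (ZY₀, (N+1)·P + ZY₁)]` at the lattice record `prFA`
    (hPl : -(5 * ((P°).r 1 : ℤ)) + 1 ≤ Skelφ.rdLo (F°).A nL° hL° vL° vβL° (F°).c₀ (F°).c₁ (F°).D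
        (![-Skelφ.kgZY₀ nL° vL° (KS0.R'0 κ Φ t p O.merged mk) ρ W N (Skelφ.kgM₁Y nL° vL° (KS0.R'0 κ Φ t p O.merged mk) ρ W N) (Skelφ.kgWm₂Y nL° vL° (KS0.R'0 κ Φ t p O.merged mk) ρ W N) (Skelφ.kgWp₂Y nL° vL° (KS0.R'0 κ Φ t p O.merged mk) ρ W N) (Skelφ.kgM₂Y nL° ℓL° hL° vL° (KS0.R'0 κ Φ t p O.merged mk) ρ qq W N), -Skelφ.kgZY₁ nL° ℓL° hL° (KS0.R'0 κ Φ t p O.merged mk) ρ qq N (Skelφ.kgM₁Y nL° vL° (KS0.R'0 κ Φ t p O.merged mk) ρ W N) (Skelφ.kgM₂Y nL° ℓL° hL° vL° (KS0.R'0 κ Φ t p O.merged mk) ρ qq W N)])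
        (![Skelφ.kgZY₀ nL° vL° (KS0.R'0 κ Φ t p O.merged mk) ρ W N (Skelφ.kgM₁Y nL° vL° (KS0.R'0 κ Φ t p O.merged mk) ρ W N) (Skelφ.kgWm₂Y nL° vL° (KS0.R'0 κ Φ t p O.merged mk) ρ W N) (Skelφ.kgWp₂Y nL° vL° (KS0.R'0 κ Φ t p O.merged mk) ρ W N) (Skelφ.kgM₂Y nL° ℓL° hL° vL° (KS0.R'0 κ Φ t p O.merged mk) ρ qq W N),
          ((N : ℤ) + 1) * ((nL° * ℓL° / Skelφ.shearUnit nL° hL° + 1 : ℕ) : ℤ) + Skelφ.kgZY₁ nL° ℓL° hL° (KS0.R'0 κ Φ t p O.merged mk) ρ qq N (Skelφ.kgM₁Y nL° vL° (KS0.R'0 κ Φ t p O.merged mk) ρ W N) (Skelφ.kgM₂Y nL° ℓL° hL° vL° (KS0.R'0 κ Φ t p O.merged mk) ρ qq W N)]) 1 ∧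
      Skelφ.rdHi (F°).A nL° hL° vL° vβL° (F°).c₀ (F°).c₁ (F°).D
        (![-Skelφ.kgZY₀ nL° vL° (KS0.R'0 κ Φ t p O.merged mk) ρ W N (Skelφ.kgM₁Y nL° vL° (KS0.R'0 κ Φ t p O.merged mk) ρ W N) (Skelφ.kgWm₂Y nL° vL° (KS0.R'0 κ Φ t p O.merged mk) ρ W N) (Skelφ.kgWp₂Y nL° vL° (KS0.R'0 κ Φ t p O.merged mk) ρ W N) (Skelφ.kgM₂Y nL° ℓL° hL° vL° (KS0.R'0 κ Φ t p O.merged mk) ρ qq W N), -Skelφ.kgZY₁ nL° ℓL° hL° (KS0.R'0 κ Φ t p O.merged mk) ρ qq N (Skelφ.kgM₁Y nL° vL° (KS0.R'0 κ Φ t p O.merged mk) ρ W N) (Skelφ.kgM₂Y nL° ℓL° hL° vL° (KS0.R'0 κ Φ t p O.merged mk) ρ qq W N)])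
        (![Skelφ.kgZY₀ nL° vL° (KS0.R'0 κ Φ t p O.merged mk) ρ W N (Skelφ.kgM₁Y nL° vL° (KS0.R'0 κ Φ t p O.merged mk) ρ W N) (Skelφ.kgWm₂Y nL° vL° (KS0.R'0 κ Φ t p O.merged mk) ρ W N) (Skelφ.kgWp₂Y nL° vL° (KS0.R'0 κ Φ t p O.merged mk) ρ W N) (Skelφ.kgM₂Y nL° ℓL° hL° vL° (KS0.R'0 κ Φ t p O.merged mk) ρ qq W N),
          ((N : ℤ) + 1) * ((nL° * ℓL° / Skelφ.shearUnit nL° hL° + 1 : ℕ) : ℤ) + Skelφ.kgZY₁ nL° ℓL° hL° (KS0.R'0 κ Φ t p O.merged mk) ρ qq N (Skelφ.kgM₁Y nL° vL° (KS0.R'0 κ Φ t p O.merged mk) ρ W N) (Skelφ.kgM₂Y nL° ℓL° hL° vL° (KS0.R'0 κ Φ t p O.merged mk) ρ qq W N)]) 1 ≤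
        22 * ((P°).r 1 : ℤ) - 1)
    (hPt : -(2 * ((P°).r 0 : ℤ)) + 1 ≤ Skelφ.rdLo (F°).A nL° hL° vL° vβL° (F°).c₀ (F°).c₁ (F°).D
        (![-Skelφ.kgZY₀ nL° vL° (KS0.R'0 κ Φ t p O.merged mk) ρ W N (Skelφ.kgM₁Y nL° vL° (KS0.R'0 κ Φ t p O.merged mk) ρ W N) (Skelφ.kgWm₂Y nL° vL° (KS0.R'0 κ Φ t p O.merged mk) ρ W N) (Skelφ.kgWp₂Y nL° vL° (KS0.R'0 κ Φ t p O.merged mk) ρ W N) (Skelφ.kgM₂Y nL° ℓL° hL° vL° (KS0.R'0 κ Φ t p O.merged mk) ρ qq W N), -Skelφ.kgZY₁ nL° ℓL° hL° (KS0.R'0 κ Φ t p O.merged mk) ρ qq N (Skelφ.kgM₁Y nL° vL° (KS0.R'0 κ Φ t p O.merged mk) ρ W N) (Skelφ.kgM₂Y nL° ℓL° hL° vL° (KS0.R'0 κ Φ t p O.merged mk) ρ qq W N)])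
        (![Skelφ.kgZY₀ nL° vL° (KS0.R'0 κ Φ t p O.merged mk) ρ W N (Skelφ.kgM₁Y nL° vL° (KS0.R'0 κ Φ t p O.merged mk) ρ W N) (Skelφ.kgWm₂Y nL° vL° (KS0.R'0 κ Φ t p O.merged mk) ρ W N) (Skelφ.kgWp₂Y nL° vL° (KS0.R'0 κ Φ t p O.merged mk) ρ W N) (Skelφ.kgM₂Y nL° ℓL° hL° vL° (KS0.R'0 κ Φ t p O.merged mk) ρ qq W N),
          ((N : ℤ) + 1) * ((nL° * ℓL° / Skelφ.shearUnit nL° hL° + 1 : ℕ) : ℤ) + Skelφ.kgZY₁ nL° ℓL° hL° (KS0.R'0 κ Φ t p O.merged mk) ρ qq N (Skelφ.kgM₁Y nL° vL° (KS0.R'0 κ Φ t p O.merged mk) ρ W N) (Skelφ.kgM₂Y nL° ℓL° hL° vL° (KS0.R'0 κ Φ t p O.merged mk) ρ qq W N)]) 0 ∧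
      Skelφ.rdHi (F°).A nL° hL° vL° vβL° (F°).c₀ (F°).c₁ (F°).D
        (![-Skelφ.kgZY₀ nL° vL° (KS0.R'0 κ Φ t p O.merged mk) ρ W N (Skelφ.kgM₁Y nL° vL° (KS0.R'0 κ Φ t p O.merged mk) ρ W N) (Skelφ.kgWm₂Y nL° vL° (KS0.R'0 κ Φ t p O.merged mk) ρ W N) (Skelφ.kgWp₂Y nL° vL° (KS0.R'0 κ Φ t p O.merged mk) ρ W N) (Skelφ.kgM₂Y nL° ℓL° hL° vL° (KS0.R'0 κ Φ t p O.merged mk) ρ qq W N), -Skelφ.kgZY₁ nL° ℓL° hL° (KS0.R'0 κ Φ t p O.merged mk) ρ qq N (Skelφ.kgM₁Y nL° vL° (KS0.R'0 κ Φ t p O.merged mk) ρ W N) (Skelφ.kgM₂Y nL° ℓL° hL° vL° (KS0.R'0 κ Φ t p O.merged mk) ρ qq W N)])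
        (![Skelφ.kgZY₀ nL° vL° (KS0.R'0 κ Φ t p O.merged mk) ρ W N (Skelφ.kgM₁Y nL° vL° (KS0.R'0 κ Φ t p O.merged mk) ρ W N) (Skelφ.kgWm₂Y nL° vL° (KS0.R'0 κ Φ t p O.merged mk) ρ W N) (Skelφ.kgWp₂Y nL° vL° (KS0.R'0 κ Φ t p O.merged mk) ρ W N) (Skelφ.kgM₂Y nL° ℓL° hL° vL° (KS0.R'0 κ Φ t p O.merged mk) ρ qq W N),
          ((N : ℤ) + 1) * ((nL° * ℓL° / Skelφ.shearUnit nL° hL° + 1 : ℕ) : ℤ) + Skelφ.kgZY₁ nL° ℓL° hL° (KS0.R'0 κ Φ t p O.merged mk) ρ qq N (Skelφ.kgM₁Y nL° vL° (KS0.R'0 κ Φ t p O.merged mk) ρ W N) (Skelφ.kgM₂Y nL° ℓL° hL° vL° (KS0.R'0 κ Φ t p O.merged mk) ρ qq W N)]) 0 ≤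
        2 * ((P°).r 0 : ℤ) - 1)
    -- READING ROWS of the arrival box `[kgLastLoY, kgLastHiY]` (SkelPhiCorridorKGBoxes)
    (hLl : 20 * ((P°).r 1 : ℤ) - b° 1 + 1 ≤ Skelφ.rdLo (F°).A nL° hL° vL° vβL° (F°).c₀ (F°).c₁ (F°).D (HK.kgLastLoY N) (HK.kgLastHiY N) 1 ∧
      5 * ((P°).r 1 : ℤ) ≤ Skelφ.rdLo (F°).A nL° hL° vL° vβL° (F°).c₀ (F°).c₁ (F°).D (HK.kgLastLoY N) (HK.kgLastHiY N) 1 ∧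
      Skelφ.rdHi (F°).A nL° hL° vL° vβL° (F°).c₀ (F°).c₁ (F°).D (HK.kgLastLoY N) (HK.kgLastHiY N) 1 ≤ 20 * ((P°).r 1 : ℤ) + b° 1 - 1 ∧
      Skelφ.rdHi (F°).A nL° hL° vL° vβL° (F°).c₀ (F°).c₁ (F°).D (HK.kgLastLoY N) (HK.kgLastHiY N) 1 ≤ 22 * ((P°).r 1 : ℤ))
    (hLt : PCells2S.cenS P° (tgt e + stepVec e₁) 0 - PCells2S.cenS P° (tgt e) 0 - b° 0 + 1 ≤ Skelφ.rdLo (F°).A nL° hL° vL° vβL° (F°).c₀ (F°).c₁ (F°).D (HK.kgLastLoY N) (HK.kgLastHiY N) 0 ∧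
      Skelφ.rdHi (F°).A nL° hL° vL° vβL° (F°).c₀ (F°).c₁ (F°).D (HK.kgLastLoY N) (HK.kgLastHiY N) 0 ≤ PCells2S.cenS P° (tgt e + stepVec e₁) 0 - PCells2S.cenS P° (tgt e) 0 + b° 0 - 1 ∧
      -(2 * ((P°).r 0 : ℤ)) ≤ Skelφ.rdLo (F°).A nL° hL° vL° vβL° (F°).c₀ (F°).c₁ (F°).D (HK.kgLastLoY N) (HK.kgLastHiY N) 0 ∧
      Skelφ.rdHi (F°).A nL° hL° vL° vβL° (F°).c₀ (F°).c₁ (F°).D (HK.kgLastLoY N) (HK.kgLastHiY N) 0 ≤ 2 * ((P°).r 0 : ℤ))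
    -- START-BOX ROWS (`aW ≤ (n ± v) + W`, `bL ≤ qq`)
    {aW Bx bL : ℤ} (ha : (F°).D * ((F°).c₁ * (nL° : ℤ) * (b° 0 + 1) + (F°).c₀ * |vL°| * (b° 1 + 1)) ≤ (F°).c₀ * (F°).c₁ * (F°).A * modulus nL° hL° vL° vβL° * aW)
    (hBx : (F°).D * ((b° 1 : ℤ) + 1) ≤ (F°).c₁ * (F°).A * Bx) (hbL : Bx / (Skelφ.shearUnit nL° hL° : ℤ) + 1 ≤ bL)
    (haW : aW ≤ ((((nL° : ℤ) + vL°).toNat + W : ℕ) : ℤ)) (haW' : aW ≤ ((((nL° : ℤ) - vL°).toNat + W : ℕ) : ℤ)) (hbq : bL ≤ qq)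
    -- DEPTH ROW
    (hRD : ((cOffS κ Φ t p O.merged g° f° * (((tgt e) 0).natAbs + ((tgt e) 1).natAbs) + 1 : ℕ) : ℤ) +
      (10 + 3) * (((N : ℤ) + 1) * ((nL° * ℓL° / Skelφ.shearUnit nL° hL° + 1 : ℕ) : ℤ) +
        Skelφ.kgZY₀ nL° vL° (KS0.R'0 κ Φ t p O.merged mk) ρ W N (Skelφ.kgM₁Y nL° vL° (KS0.R'0 κ Φ t p O.merged mk) ρ W N) (Skelφ.kgWm₂Y nL° vL° (KS0.R'0 κ Φ t p O.merged mk) ρ W N) (Skelφ.kgWp₂Y nL° vL° (KS0.R'0 κ Φ t p O.merged mk) ρ W N) (Skelφ.kgM₂Y nL° ℓL° hL° vL° (KS0.R'0 κ Φ t p O.merged mk) ρ qq W N) + Skelφ.kgZY₁ nL° ℓL° hL° (KS0.R'0 κ Φ t p O.merged mk) ρ qq N (Skelφ.kgM₁Y nL° vL° (KS0.R'0 κ Φ t p O.merged mk) ρ W N) (Skelφ.kgM₂Y nL° ℓL° hL° vL° (KS0.R'0 κ Φ t p O.merged mk) ρ qq W N)) ≤ R)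
    -- THE RIM EXCESS DEVICE: world rows, excess radius
    {φe : V → Site 2} {Rw m' m R₁ : ℕ} {ctr : Site 2}
    (hWπ : ∀ b ∈ (S°).Γ.Ewv ((S°).aOf₁O G h e) e.1 e.2 ∪ (FD°).Hfull ((S°).aOf₂O G h e) (tgt e) e₁, b ∈ graphBall G t Rw)
    (hWpl : ∀ b ∈ (S°).Γ.Ewv ((S°).aOf₁O G h e) e.1 e.2 ∪ (FD°).Hfull ((S°).aOf₂O G h e) (tgt e) e₁, φe b ∈ (box 2 m').image (fun s => s + ctr))
    (hm : 2 * m' ≤ m)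
    (hR₁ : ∀ R'', R₁ ≤ R'' → ∀ (Rw' : ℕ) (D' A' : Finset V), (∀ d ∈ D', d ∈ graphBall G t Rw') →
      (∀ d ∈ D', ∀ d' ∈ D', φe d - φe d' ∈ box 2 m) → A' ⊆ D' → (∀ a ∈ A', a ∈ graphBall G t (R₀ + 1)) →
        (bondPercolation G q).real (excess G t R'' D' A') ≤ κ.δr 0 / 2)
    (hR₁R : R₁ ≤ R - KS0.r₀0 t O.merged mk (RL κ Φ t p O gv fv))
    -- the budget
    {nmax : ℕ} (hnmax : (Skelφ.kgCorrSchedY HK.hn HK.hv HK.hlay (HK.kgYVals_ok₁ N) (HK.kgYVals_ok₂ N) (HK.kgYVals_split N)).N ≤ nmax) :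
    ReachOblAtHNF G nmax S° FD° Φ.Δ (κ.δr 0) h e ((S°).aOf₂O G h e) e₁ := by
  -- the long clause and its numerics
  have hN := eqNumL_of_atQ hAt
  obtain ⟨hn1, hℓ1⟩ := one_le_of_eqNumL κ Φ t p O.merged g° f° hN
  have hκL := (clauseL_of_atQ hAt).2
  obtain ⟨-, hq1, hq2, -⟩ := factsNS_of_atQ hAt
  -- the frame
  have hlipφ := lip_φL κ Φ t p O.D O.DT.toDataN O.ori g° f°
  have hstep := steps_φL κ Φ t p O.D O.DT.toDataN O.ori g° f°
  -- the Γ package at the staggered cells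
  obtain ⟨-, -, -, -, -, -, hEx, hSt, hL⟩ := geom_fineA_at_bS κ Φ t p O.merged g° f° c° hlipφ hstep hN
    (schedOfS_WFS2 κ Φ t p O.merged g° f° c° (Sv κ Φ t p O.merged g° f° q)) (colQ_schedOfS κ Φ t p O.merged g° f° c° (Sv κ Φ t p O.merged g° f° q))
    (b₀ := b°) (bOf_le κ Φ t p O gv fv cv bv)
  -- the kit block
  obtain ⟨hPN, hdD, hDρ, hKCmax, hT, -⟩ := KS0.kit0_ok t O.merged mk ((Mu O.merged + 1 : ℕ) * (Skelφ.shearUnit nL° hL° : ℤ) + 1)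
    (KS0.r₀0 t O.merged mk (RL κ Φ t p O gv fv)) (kq := 10) le_rfl
  obtain ⟨hrs, hcS⟩ := KS0.kit0_sizes Φ t O.merged mk ((Mu O.merged + 1 : ℕ) * (Skelφ.shearUnit nL° hL° : ℤ) + 1) (KS0.r₀0 t O.merged mk (RL κ Φ t p O gv fv))
  obtain ⟨hr₀, hr₀1⟩ := KS0.hr₀_kit0 t O.merged mk ((Mu O.merged + 1 : ℕ) * (Skelφ.shearUnit nL° hL° : ℤ) + 1) (KS0.r₀0_ge t O.merged mk (RL κ Φ t p O gv fv)).1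
  have hreach := KS0.hreach_kit0 t O.merged mk ((Mu O.merged + 1 : ℕ) * (Skelφ.shearUnit nL° hL° : ℤ) + 1) (KS0.r₀0_ge t O.merged mk (RL κ Φ t p O gv fv)).2
  -- the counts at the flat root accuracy
  obtain ⟨hk, hcount⟩ := KS0.counts_atq_root κ Φ t p O.merged mk hp0 hp1 hq1 hq2
  -- levels
  have hE : KS0.j₁0 κ Φ t p O.merged mk +
      ((KS0.kit0 t O.merged mk ((Mu O.merged + 1 : ℕ) * (Skelφ.shearUnit nL° hL° : ℤ) + 1) (KS0.r₀0 t O.merged mk (RL κ Φ t p O gv fv))).N *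
          (tanOff (KS0.kit0 t O.merged mk ((Mu O.merged + 1 : ℕ) * (Skelφ.shearUnit nL° hL° : ℤ) + 1) (KS0.r₀0 t O.merged mk (RL κ Φ t p O gv fv))).ℓs
            (KS0.kit0 t O.merged mk ((Mu O.merged + 1 : ℕ) * (Skelφ.shearUnit nL° hL° : ℤ) + 1) (KS0.r₀0 t O.merged mk (RL κ Φ t p O gv fv))).M + 1) +
        (KS0.kit0 t O.merged mk ((Mu O.merged + 1 : ℕ) * (Skelφ.shearUnit nL° hL° : ℤ) + 1) (KS0.r₀0 t O.merged mk (RL κ Φ t p O gv fv))).N *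
          (KS0.kit0 t O.merged mk ((Mu O.merged + 1 : ℕ) * (Skelφ.shearUnit nL° hL° : ℤ) + 1) (KS0.r₀0 t O.merged mk (RL κ Φ t p O gv fv))).d +
        KS.KCmax t O.merged mk) ≤ KS0.R'0 κ Φ t p O.merged mk := by
    rw [KS0.tanOff_kit0]
    simp only [KS0.kit0]
    have h := (KS0.R'0_eq κ Φ t p O.merged mk).1
    unfold KS0.reach0 at h
    omega
  exact Skelφ.reachOblAtHNF_of_kgCorrYSD (φ := φL°) (ψ := ψ°) (P := P°) (w₀ := t) (Λ := Λ°) (b₀ := b°) (q := q) (δc := κ.δ)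
    (hψ := fineOA_eq_fineSkel) (hAp := (Aof_pos κ).1) (hmp := Skelφ.NegPrm.modulus_vβOf_pos hn1 hℓ1 _ _)
    (hc₀p := (prFA_c_pos κ Φ t p O.merged g° f°).1) (hc₁p := (prFA_c_pos κ Φ t p O.merged g° f°).2)
    (hDp := Skelφ.NegPrm.DofA_pos (Aof_pos κ).2 hn1 hℓ1 _ _)
    (hlip := lip_fineA_at κ Φ t p O.merged g° f° hlipφ hN) (hws := weakSteps_fineA_at κ Φ t p O.merged g° f° hstep hN)
    (hb := bOf_le κ Φ t p O gv fv cv bv) (hL := hL) (hSt := hSt) (hEx := hEx) (hV := hV) (hdu := hdu) (hdu' := hne)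
    (hlipφ := hlipφ) (hstep := hstep) (hΔ := Φ.degree_le) (hn := HK.hn) (hvn := HK.hv) (hlay := HK.hlay)
    (c₀ := colVS κ Φ t p O.merged g° f° c° hlipφ hstep hN (tgt e)) (kq := 10) (hκL := hκL)
    (hctr := colVS_eq κ Φ t p O.merged g° f° c° hlipφ hstep hN (tgt e))
    (hP₁ := HK.kgYVals_ok₁ N) (hP₂ := HK.kgYVals_ok₂ N) (hsplit := HK.kgYVals_split N) (r := RL κ Φ t p O gv fv) (hr := le_rfl)
    (hrR := le_trans (Nat.le_add_right _ _) ((KS0.r₀0_ge t O.merged mk (RL κ Φ t p O gv fv)).2.trans hr₀R))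
    (Pk := KS0.kit0 t O.merged mk ((Mu O.merged + 1 : ℕ) * (Skelφ.shearUnit nL° hL° : ℤ) + 1) (KS0.r₀0 t O.merged mk (RL κ Φ t p O gv fv)))
    (hPN := hPN) (hA := rfl) (hdD := hdD) (hDρ := hDρ) (hKCmax := hKCmax) (hT := hT) (hr₀ := hr₀) (hR := hr₀R) (hr₀1 := hr₀1)
    (hrs := hrs) (hcS := hcS) (hreach := hreach)
    (Rg := fun c => KS.RgK G t O.merged mk (KS.φK Φ t O.D O.DT.toDataN O.ori mk) c)
    (hRg := fun c => KS.RgK_subset_graphBall t O.merged mk _ c) (hRgcard := fun c => KS.card_RgK_le Φ t O.merged mk _ c)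
    (hcU1 := Nat.one_le_pow _ _ (Nat.succ_pos _))
    (Λc := O.merged.Λ) (kz := Mu O.merged) (hΛRg := hΛRg_of_atQ mk hAt) (hzconn := hzconn_of_atQ hAt) (hcz := hcz_of_atQ hAt)
    (hj0 := (KS0.tanOff_kit0 t O.merged mk _ _).le) (hj := (KS0.R'0_eq κ Φ t p O.merged mk).2.2) (hRl := (KS0.R'0_eq κ Φ t p O.merged mk).2.1.le)
    (hE := hE) (hδ := (κ.hδr 0).1) (hη := le_rfl) (kk := KS0.kk0 κ Φ t p O.merged mk) (hN := KS0.hNk0_at κ Φ t p O.merged mk hp0 hp1)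
    (hk := hk) (hcount := hcount)
    (hDQ := hDQ) (hDρ' := hDρ') (hρM := hρM) (hdeep := hdeep) (hPl := hPl) (hPt := hPt) (hlast := fun y hy => HK.mem_Icc_of_mem_lastY N hy) (hLl := hLl) (hLt := hLt)
    (ha := ha) (hBx := hBx) (hbL := hbL) (haW := haW) (haW' := haW') (hbq := hbq)
    (hc₀ := colVS_mem_graphBall_lin κ Φ t p O.merged g° f° c° hlipφ hstep hN hκL (tgt e)) (hRD := hRD)
    (hWπ := hWπ) (hWpl := hWpl) (hm := hm) (hR₁ := hR₁) (hR₁R := hR₁R)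
    (hlong := hlong_of_atQ3 hAt h1 (Neg.δkit_le_δr κ Φ (by norm_num)))
    (hlongY := hlongY_of_atQ3 hAt h1 (Neg.δkit_le_δr κ Φ (by norm_num)))
    (hnmax := hnmax)

end Fst

end NegB

end PlanarSkeletonFrmFrom

end Summit.CriticalPhenomena.PercolationContinuityZ3.Theorems.Transplant

end
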